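import Literature.Claims.NS.Permana2026
import HarnessLib

/-!
# C150 `Fathi2025` — K. Fathi, «Global Regularity of the 3D Incompressible Navier–Stokes Equations via
# Energy Estimates, Bootstrap Closure, and Vorticity Control» (Zenodo 15384518, May 2025, 7 pp.)

Claim skeleton of the D-0090 «where NS proofs break» map (cell `ns-claims`), typist of record
ns-claims-typist-12 g5. Text of record = the census staging copy as PINNED (RULINGS v1.36 (1)):
`census/texts/Fathi2025/` (PDF «Navier_Stokes_2_0.pdf» sha16 ccfa546aeee3c05c; PDF page = file pNNN;
line numbers below = those of the text layer `pages/pNNN.txt`). Direction REG on `ℝ³`, FORCED (smooth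
compactly supported force), data `H^s`, `s > 5/2` — Clay (A) with two STRONGER-than-(A) axes (force, data).

## The printed statements (verbatim)

* **Theorem 1.1 (Global Regularity)** (p.2 l.6–22): «Let u₀ ∈ H^s(ℝ³) for s > 5/2 be divergence-free, and
  let f ∈ C_c^∞([0,∞) × ℝ³). Then there exists a unique global solution u ∈ C^∞([0,∞) × ℝ³) to the
  Navier–Stokes equations (1), and for each T > 0, we have sup_{t∈[0,T]} ‖u(t)‖_{H^s} < ∞. In particular,
  the solution remains smooth for all t > 0.»
* **Lemma 2.1 (Gagliardo–Nirenberg)** (p.2 l.65–73): «‖f‖_{L⁶} ≲ ‖∇f‖_{L²}, ‖f‖_{L³} ≲ ‖f‖^{1/2}_{L²}‖∇f‖^{1/2}_{L²}»;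
  **Lemma 2.2 (Biot–Savart)** (p.2 l.74–75): «‖∇u‖_{L^p} ≲ ‖ω‖_{L^p}», 1 < p < ∞; **Lemma 2.3 (BKM [1])**
  (p.2 l.76–80); **§2.3 local well-posedness** (p.3 l.1–8): «there exists a time T* > 0 and a unique solution
  u ∈ C([0,T*); H^s) … Our goal is to show that the solution persists globally in time by controlling
  ‖u(t)‖_{H^s} uniformly.»
* **§3.1** (p.3 l.12–36): «½ d/dt‖u‖²_{L²} + ν‖∇u‖²_{L²} = ⟨f,u⟩ ≤ (1/2ν)‖f‖²_{L²} + (ν/2)‖u‖²_{L²}. By Grönwall's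
  inequality, we obtain a global bound on ‖u(t)‖_{L²}».
* **§3.2** (p.3 l.37–89, p.4 l.1–13): vorticity equation «∂ₜω + (u·∇)ω = (ω·∇)u + ν∆ω + ∇×f»; enstrophy
  identity «½ d/dt‖ω‖²_{L²} + ν‖∇ω‖²_{L²} = ∫(ω·∇)u·ω dx + ⟨∇×f, ω⟩»; «We estimate the stretching term using
  Hölder and interpolation: |∫(ω·∇)u·ω| ≲ ‖ω‖²_{L³}‖∇u‖_{L³} ≲ ‖ω‖_{L²}‖∇ω‖_{L²}‖ω‖_{L²}. Using the
  Biot–Savart estimate ‖∇u‖_{L³} ≲ ‖ω‖_{L³} and applying Young's inequality, we obtain: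
  ∫(ω·∇)u·ω ≤ (ν/2)‖∇ω‖²_{L²} + C_ν‖ω‖⁶_{L²}»; forcing term «⟨∇×f,ω⟩ ≤ ½‖∇×f‖²_{L²} + ½‖ω‖²_{L²}»;
  «Combining, we obtain the differential inequality: d/dt‖ω‖²_{L²} ≤ C₁‖ω‖²_{L²} + C₂‖ω‖⁶_{L²} + ‖∇×f‖²_{L²}.»
  (p.4 l.1–11).
* **§4.1** (p.4 l.18–59): «Assume that for some T > 0, we have ‖ω(t)‖²_{L²} ≤ M, for all t ∈ [0,T), for a
  constant M > 0 to be determined. … Letting y(t) := ‖ω(t)‖²_{L²} and assuming ‖∇×f(t)‖_{L²} ≤ F₀ uniformly,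
  we obtain: dy/dt ≤ C₁y + C₂y³ + F₀². **Lemma 4.1 (Subcritical Growth Exclusion).** Let y(t) satisfy
  dy/dt ≤ C₁y + C₂y³ + F₀², y(0) = y₀. Then there exists M = M(C₁,C₂,F₀,y₀,T) > 0 such that if y₀ < M, then
  y(t) ≤ M for all t ∈ [0,T], and no finite-time blow-up occurs. Proof. Define an auxiliary function z(t) by
  dz/dt = C₁z + C₂z³ + F₀², z(0) = y₀. For small y₀ or large M, the right-hand side remains bounded on [0,T].
  By the comparison principle, y(t) ≤ z(t), and standard ODE theory implies z(t) stays finite on [0,T], thus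
  so does y(t). Therefore, the vorticity remains uniformly bounded and the bootstrap assumption is
  self-consistent.»
* **§4.2** (p.5 l.1–45): «d/dt E_s(t) + ν‖u(t)‖²_{H^{s+1}} ≤ C_s‖u(t)‖³_{H^s} + ‖f(t)‖²_{H^s}» (Lemma 4.2
  Kato–Ponce [7]); «close the bootstrap by assuming: ‖u(t)‖²_{H^s} ≤ K for all t ∈ [0,T], which yields:
  d/dt E_s(t) ≤ C_sK^{3/2} + ‖f(t)‖²_{H^s}. Integrating gives: ‖u(t)‖²_{H^s} ≤ ‖u₀‖²_{H^s} + C_sK^{3/2}T +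
  ∫₀ᵀ‖f(t)‖²_{H^s}dt. Choosing K large enough to dominate the right-hand side ensures the estimate closes.
  Hence ‖u(t)‖_{H^s} remains uniformly bounded on [0,T].»
* **§4.3** (p.5 l.46–49): «Since the constants … depend only on the initial data u₀ and forcing f, and not on
  T, we may iterate the argument over successive time intervals to cover [0,∞).»; **§5** (p.5 l.50–67, p.6
  l.1–18): Sobolev embedding «‖ω(t)‖_{L∞} ≲ ‖u(t)‖_{H^s}», «sup_{[0,T]}‖ω‖_{L∞} ≤ C_T < ∞», BKM ⇒ «the
  solution exists globally … This completes the proof of Theorem 1.1.»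

## How it is typed

The BKM-class rendering of C17/C119/C148 (`Chae2007.IsDatum`: smooth, divergence-free, every derivative in
`L²` — the `H^∞ ∩ C^∞` data; `HasBoundedSobolevNormsOn` slabs), WITH A FORCE: `IsForce f` = «f ∈
C_c^∞([0,∞) × ℝ³)» (jointly smooth, compactly supported in space-time), `IsLocalForcedSolution` /
`IsGlobalForcedSolution` = the tree's `IsClassicalNSSolutionOn S ν f u p` + initial slice + Sobolev bounds on
compact sub-slabs (for `f ≡ 0` these ARE `Chae2007.IsLocalSolution` / `IsGlobalSolution`:
`isGlobalForcedSolution_zero_iff`). `ClaimedTheorem` = Thm 1.1 existence for every `ν > 0`, every class datum,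
every `IsForce f`; `ClaimedUniqueness` its «unique» clause. Deltas recorded, not typed: the printed data class
`H^s`, `s > 5/2` is WIDER than the rendering (the typed headline is weaker than printed — charitable; read
literally, «u ∈ C^∞([0,∞) × ℝ³)» fails at `t = 0` for non-smooth `H^s` data, a statement-grain slip); «for each
T, sup_{[0,T]}‖u‖_{H^s} < ∞» = the `sobolev` clause. Clay: `f ≡ 0` is an admissible force (`isForce_zero`), so
`ClaimedTheorem → Permana2026.ClaimedTheorem` (`unforced_of_claimed`) and **`clay_of_claimed : ClaimedTheorem →
clayR3.Regularity` is PROVED** through the C119 door; Δ3 (compactly supported forces CARRIED — a sub-case of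
Fefferman's class (5), Tao's Conj. 1.5 shape) and Δ4 (data) are STRONGER-than-(A) axes, no wrong problem.
Quantities: `ensq u t = ‖ω(t)‖²_{L²}` (= `Permana2026.enstrophy`), `curlSq f t = ‖∇×f(t)‖²_{L²}`,
`hs3 u t = Σ_{n≤3}∫|Dⁿu(t)|²` in `ℝ≥0∞` (the rendering of `‖u(t)‖²_{H^s}`; `Chae2007.BlowsUpAt T u` is
literally «`hs3 u` unbounded on `[0,T)`»).

## Step table (dependency order as printed)

| Step | decl | print | typed content | typist's note |
|---|---|---|---|---|
| 2.1–2.3 | (recorded) | Lemmas 2.1–2.3 p.2 | GN, Biot–Savart, BKM | classical, TRUE (tree: `WholeSpaceGagliardoNirenbergSup`, Calderón–Zygmund files, `MajdaBertozzi2002_bkmAprioriH3_holds`); not re-typed |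
| 2.3′ | `Step23_local` | §2.3 p.3 l.1–8 (+ Lemma 2.3) | forced local well-posedness as the dichotomy «global class solution OR a class solution on some [0,T) that blows up at T» | classical, TRUE-type (the forced twin of `Chae2007.Step_1`) |
| 3.1 | (recorded) | §3.1 p.3 | energy bound by Grönwall | TRUE, unused downstream |
| 3.2 | `Step32_ineq` | §3.2 last display p.4 l.1–11 | along every forced local class solution: `d⁺/dt ‖ω‖² ≤ C₁‖ω‖² + C₂‖ω‖⁶ + ‖∇×f‖²` (C₁, C₂ per ν) | TRUE-type (classical 3D enstrophy inequality; the middle display «≲ ‖ω‖₂‖∇ω‖₂‖ω‖₂» p.3 l.65–67 is NOT what Lemma 2.1/2.2 give — scaling λ³ vs λ^{5/2} — but the Young'd display is the classical one; recorded) |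
| 4.1 | **`Step41_used`** | §4.1 p.4 l.43–59, Lemma 4.1 as USED («Therefore, the vorticity remains uniformly bounded») | at the ODE grain: every `y ≥ 0` on `[0,T)` with `y' ≤ C₁y + C₂y³ + F₀²` (right derivative) is bounded on `[0,T)` | known-false pattern (`y = y₀(1 − 2C₂y₀²t)^{−1/2}`); the LITERAL Lemma 4.1 («∃ M … if y₀ < M then y ≤ M on [0,T]») is not separately typed: read on the closed slab it is true by compactness, read with «M ≤ y₀» it is empty — recorded |
| 4.1′ | `Step41_inference` | p.4 l.24–42 + l.59 | `Step32_ineq → Step41_used →` enstrophy bounded on `[0,T)` along every forced local class solution | the printed inference (needs `sup‖∇×f‖² < ∞`, true for `IsForce`) |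
| 4.2a | `Step42_cubic` | §4.2 first display p.5 l.7–14 | `d⁺/dt hs3 ≤ C_s hs3^{3/2} + ‖f‖²_{H³}` (good term dropped) | TRUE-type classical (Kato–Ponce, s = 3 rendering) |
| 4.2b | **`Step42_close`** | p.5 l.44 «Choosing K large enough to dominate the right-hand side ensures the estimate closes» | real arithmetic: `∃ K₀, ∀ K ≥ K₀, E₀ + C_sK^{3/2}T + F ≤ K` | known-false pattern (`K^{3/2}` beats `K`): the census's «bootstrap inequality»; kernel-trivial |
| 4.2c | `Step42_inference` | p.5 l.24–45 | `Step42_cubic → Step42_close →` `hs3` bounded on `[0,T)` along every forced local class solution (`HsBounded`) | the printed inference («which yields … Integrating gives … Hence») |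
| 4.3/5 | `Step5_BKM` | §4.3 p.5 + §5 pp.5–6 | bounded `hs3` on `[0,T)` ⇒ no blow-up at `T` | TRUE — definitional in the rendering (`step5_BKM_holds`) |

Composition PROVED: `claim_of_steps : Step23_local → Step42_cubic → Step42_close → Step42_inference → ClaimedTheorem`
(§4.2 → §5 path; Step 5 discharged inside); `claim_of_steps_vort` records the §4.1 branch
(`Step32_ineq → Step41_used → Step41_inference → VortBoundedAll`), which §4.2–§5 do not consume in print.

## Kernel handles (typist's reading, no assertion; the refuter decides the grain)

(a) `Step42_close`: `E₀ = 0, C_s = T = 1, F = 0`: for `K ≥ max K₀ 4`, `K^{3/2} ≥ 2K > K` (`Real.rpow` with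
exponent `3/2`, or `K * Real.sqrt K`) — as typed the def uses `K * Real.sqrt K` for `K^{3/2}`. (b) `Step41_used`:
`C₁ = F₀ = 0, C₂ = 1`: `y t = (1 − 2t)^{−1/2}` on `[0, 1/2)` has `y' = y³` (Mathlib `Real.rpow`/`Real.sqrt`
calculus, `HasDerivWithinAt` from `HasDerivAt`) and is unbounded. (c) `Step32_ineq`, `Step42_cubic`,
`Step23_local` are TRUE-type (tree: `VorticityEnstrophyGronwallForced`, `BKMClassEnstrophyContinuity`,
`NSVorticityBKMMaximal` for the unforced twin). (d) Solution-level faces (`VortBoundedAll`, `HsBounded` for all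
local class solutions) are (A)-hard at `f = 0` — not handles.

## References

* [Fathi2025] K. Fathi, *Global Regularity of the 3D Incompressible Navier–Stokes Equations via Energy
  Estimates, Bootstrap Closure, and Vorticity Control*, Zenodo 15384518 (2025).
* [FeffermanClay2006] C. L. Fefferman, CMI 2006, (A) with (4) (5) (7) p. 2.
* [BealeKatoMajda1984] J. T. Beale, T. Kato, A. Majda, Comm. Math. Phys. 94 (1984).
* [MajdaBertozziCUP2002] A. J. Majda, A. L. Bertozzi, CUP 2002, Thm 3.6.

WHAT THIS IS NOT: not a claim about NS regularity or blow-up; not a claim about any author beyond the typed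
locator.
-/

noncomputable section

open Set MeasureTheory
open scoped ContDiff ENNReal NNReal Topology

namespace Literature.Claims.NS.Fathi2025

open Literature.Analysis.FluidPDE Literature.Claims.NS.ClayVariants
open Literature.Claims.NS.Chae2007 (IsDatum IsLocalSolution IsGlobalSolution BlowsUpAt)
open Literature.Claims.NS.Permana2026 (enstrophy)

/-- `ℝ³`. [cite: Fathi2025, (1) p.1] -/
abbrev E3 : Type := EuclideanSpace ℝ (Fin 3)

/-! ## The force class and forced class solutions -/

/-- «f ∈ C_c^∞([0,∞) × ℝ³)»: jointly smooth and compactly supported in space-time (read on all of `ℝ × ℝ³`;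
only `t ≥ 0` is ever used). [cite: Fathi2025, Thm 1.1 p.2 l.10–15] -/
def IsForce (f : ℝ → E3 → E3) : Prop :=
  ContDiff ℝ ∞ (Function.uncurry f) ∧ HasCompactSupport (Function.uncurry f)

/-- `f ≡ 0` is an admissible force. [cite: Fathi2025, Thm 1.1 p.2 l.10–15] -/
theorem isForce_zero : IsForce 0 := by
  refine ⟨?_, ?_⟩
  · have : Function.uncurry (0 : ℝ → E3 → E3) = fun _ => 0 := by funext ⟨t, x⟩; rfl
    rw [this]; exact contDiff_const
  · have : Function.uncurry (0 : ℝ → E3 → E3) = 0 := by funext ⟨t, x⟩; rfl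
    rw [this]; exact HasCompactSupport.zero

/-- A FORCED class solution on `[0,T)`: classical solution of (1) with force `f` on `ℝ³ × [0,T)`, `u(0) = v₀`,
all `L²` Sobolev norms bounded on every `[0,T'']`, `T'' < T` («u ∈ C([0,T*); H^s)», §2.3 p.3 l.6).
[cite: Fathi2025, §2.3 p.3 l.1–8] -/
structure IsLocalForcedSolution (ν T : ℝ) (f : ℝ → E3 → E3) (v₀ : E3 → E3) (u : ℝ → E3 → E3)
    (p : ℝ → E3 → ℝ) : Prop where
  /-- (1) holds classically on `ℝ³ × [0,T)` with force `f`. -/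
  isClassical : IsClassicalNSSolutionOn (Ico 0 T) ν f u p
  /-- `u|_{t=0} = u₀`. -/
  initial : u 0 = v₀
  /-- Sobolev norms bounded on compact sub-slabs. -/
  sobolev : ∀ T'' < T, HasBoundedSobolevNormsOn (Icc 0 T'') u

/-- A GLOBAL forced class solution («global solution … for each T > 0, sup_{[0,T]}‖u(t)‖_{H^s} < ∞», Thm 1.1).
[cite: Fathi2025, Thm 1.1 p.2 l.15–22] -/
structure IsGlobalForcedSolution (ν : ℝ) (f : ℝ → E3 → E3) (v₀ : E3 → E3) (u : ℝ → E3 → E3)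
    (p : ℝ → E3 → ℝ) : Prop where
  /-- (1) holds classically on `ℝ³ × [0,∞)` with force `f`. -/
  isClassical : IsClassicalNSSolutionOn (Ici 0) ν f u p
  /-- `u|_{t=0} = u₀`. -/
  initial : u 0 = v₀
  /-- «for each T > 0, sup_{t∈[0,T]} ‖u(t)‖_{H^s} < ∞». -/
  sobolev : ∀ T'' : ℝ, HasBoundedSobolevNormsOn (Icc 0 T'') u

/-- With `f ≡ 0` the forced global class solution IS the C17/C119 global class solution.
[cite: Fathi2025, Thm 1.1 p.2] -/
theorem isGlobalForcedSolution_zero_iff {ν : ℝ} {v₀ : E3 → E3} {u : ℝ → E3 → E3} {p : ℝ → E3 → ℝ} :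
    IsGlobalForcedSolution ν 0 v₀ u p ↔ IsGlobalSolution ν v₀ u p :=
  ⟨fun h => ⟨h.isClassical, h.initial, h.sobolev⟩, fun h => ⟨h.isClassical, h.initial, h.sobolev⟩⟩

/-! ## The claimed statement -/

/-- **Theorem 1.1 (existence part), BKM-class rendering**: for every `ν > 0`, every class datum and every
`f ∈ C_c^∞([0,∞) × ℝ³)` there is a global forced class solution. [cite: Fathi2025, Thm 1.1 p.2 l.6–22] -/
def ClaimedTheorem : Prop :=
  ∀ ν : ℝ, 0 < ν → ∀ v₀ : E3 → E3, IsDatum v₀ → ∀ f : ℝ → E3 → E3, IsForce f →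
    ∃ (u : ℝ → E3 → E3) (p : ℝ → E3 → ℝ), IsGlobalForcedSolution ν f v₀ u p

/-- **«unique»** (Thm 1.1 p.2 l.15): two global forced class solutions from the same datum and force have the
same velocity at every `t ≥ 0`. [cite: Fathi2025, Thm 1.1 p.2 l.15] -/
def ClaimedUniqueness : Prop :=
  ∀ ν : ℝ, 0 < ν → ∀ v₀ : E3 → E3, IsDatum v₀ → ∀ f : ℝ → E3 → E3, IsForce f →
    ∀ (u u' : ℝ → E3 → E3) (p p' : ℝ → E3 → ℝ),
      IsGlobalForcedSolution ν f v₀ u p → IsGlobalForcedSolution ν f v₀ u' p' → ∀ t : ℝ, 0 ≤ t → u' t = u t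

/-- The claim specialised to `f ≡ 0` is the C119 headline (`Permana2026.ClaimedTheorem`).
[cite: Fathi2025, Thm 1.1 p.2] -/
theorem unforced_of_claimed (h : ClaimedTheorem) : Permana2026.ClaimedTheorem := by
  intro ν hν v₀ hv₀
  obtain ⟨u, p, hsol⟩ := h ν hν v₀ hv₀ 0 isForce_zero
  exact ⟨u, p, isGlobalForcedSolution_zero_iff.1 hsol⟩

/-- **`ClaimedTheorem` implies Clay (A)** (`f ≡ 0` is a compactly supported smooth force; Clay data are class
data; C119 door `Permana2026.clay_of_claimed`). [cite: FeffermanClay2006, statement (A), CMI offprint p. 2] -/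
theorem clay_of_claimed (h : ClaimedTheorem) : ClayVariants.clayR3.Regularity :=
  Permana2026.clay_of_claimed (unforced_of_claimed h)

/-! ## Quantities -/

/-- `y(t) = ‖ω(t)‖²_{L²}` (§3.2 p.3, §4.1 p.4 l.35) — the C119 `enstrophy`. [cite: Fathi2025, §4.1 p.4 l.35] -/
def ensq (u : ℝ → E3 → E3) (t : ℝ) : ℝ := enstrophy u t

/-- `‖∇×f(t)‖²_{L²}` (§3.2 p.3 l.79–89). [cite: Fathi2025, §3.2 p.3 l.79] -/
def curlSq (f : ℝ → E3 → E3) (t : ℝ) : ℝ := (∫⁻ x, ‖curl (f t) x‖ₑ ^ 2).toReal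

/-- `‖u(t)‖²_{H^s}` rendered as the `H³` sum `Σ_{n≤3} ∫|Dⁿu(t)|²` in `ℝ≥0∞` (the currency of
`Chae2007.BlowsUpAt`). [cite: Fathi2025, §2.1 p.2 l.59–62 («E_s(t) := ‖u(t)‖²_{H^s}»)] -/
def hs3 (u : ℝ → E3 → E3) (t : ℝ) : ℝ≥0∞ := ∑ n ∈ Finset.range 4, ∫⁻ x, ‖iteratedFDeriv ℝ n (u t) x‖ₑ ^ 2

/-- `‖f(t)‖²_{H^s}` rendered likewise. [cite: Fathi2025, §4.2 p.5 l.12–14] -/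
def hs3Force (f : ℝ → E3 → E3) (t : ℝ) : ℝ := (∑ n ∈ Finset.range 4, ∫⁻ x, ‖iteratedFDeriv ℝ n (f t) x‖ₑ ^ 2).toReal

/-- «‖u(t)‖_{H^s} remains uniformly bounded on [0,T]» rendered on the existence slab `[0,T)`: the `H³` sums are
bounded there — literally the negation of `Chae2007.BlowsUpAt T u`. [cite: Fathi2025, §4.2 p.5 l.44–45] -/
def HsBounded (T : ℝ) (u : ℝ → E3 → E3) : Prop :=
  ∃ A : ℝ≥0, ∀ t ∈ Ico 0 T, hs3 u t ≤ (A : ℝ≥0∞)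

/-- `HsBounded T u ↔ ¬ BlowsUpAt T u` (definitional). [cite: Fathi2025, §5.3 p.6 l.15–18] -/
theorem hsBounded_iff_not_blowsUpAt {T : ℝ} {u : ℝ → E3 → E3} : HsBounded T u ↔ ¬ BlowsUpAt T u := by
  unfold HsBounded BlowsUpAt hs3
  push Not
  rfl

/-- «the vorticity remains uniformly bounded» on the bootstrap slab `[0,T)` (§4.1 p.4 l.19–22, l.59).
[cite: Fathi2025, §4.1 p.4 l.19–22] -/
def VortBounded (T : ℝ) (u : ℝ → E3 → E3) : Prop :=
  ∃ M : ℝ, ∀ t ∈ Ico 0 T, ensq u t ≤ M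

/-- The §4.1 conclusion for every forced local class solution. [cite: Fathi2025, §4.1 p.4 l.59] -/
def VortBoundedAll : Prop :=
  ∀ (ν T : ℝ), 0 < ν → 0 < T → ∀ (f : ℝ → E3 → E3), IsForce f → ∀ (v₀ : E3 → E3) (u : ℝ → E3 → E3)
    (p : ℝ → E3 → ℝ), IsLocalForcedSolution ν T f v₀ u p → VortBounded T u

/-! ## The steps -/

/-- **Step 2.3′ — local well-posedness + continuation as the dichotomy** (§2.3 p.3 l.1–8 with Lemma 2.3 p.2):
for `ν > 0`, a class datum and a force of the class, EITHER a global forced class solution exists OR there are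
`T > 0` and a forced class solution on `[0,T)` blowing up at `T` (the forced twin of `Chae2007.Step_1`).
Classical (Kato; BKM continuation), TRUE-type. [cite: Fathi2025, §2.3 p.3 l.1–8] [cite: BealeKatoMajda1984, Thm 1] -/
def Step23_local : Prop :=
  ∀ ν : ℝ, 0 < ν → ∀ v₀ : E3 → E3, IsDatum v₀ → ∀ f : ℝ → E3 → E3, IsForce f →
    (∃ (u : ℝ → E3 → E3) (p : ℝ → E3 → ℝ), IsGlobalForcedSolution ν f v₀ u p) ∨
      ∃ T : ℝ, 0 < T ∧ ∃ (u : ℝ → E3 → E3) (p : ℝ → E3 → ℝ),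
        IsLocalForcedSolution ν T f v₀ u p ∧ BlowsUpAt T u

/-- **Step 3.2 — the enstrophy differential inequality** (p.4 l.1–11 «d/dt‖ω‖²_{L²} ≤ C₁‖ω‖²_{L²} + C₂‖ω‖⁶_{L²} +
‖∇×f‖²_{L²}»), typed along forced local class solutions with constants per viscosity, as a right derivative of
`y = ‖ω‖²` within `[t,∞)`. Classical in 3D (enstrophy identity + `∫|ω|³ ≲ ‖ω‖₂^{3/2}‖∇ω‖₂^{3/2}` + Young),
TRUE-type. [cite: Fathi2025, §3.2 p.4 l.1–11] -/
def Step32_ineq : Prop :=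
  ∀ ν : ℝ, 0 < ν → ∃ C₁ C₂ : ℝ, 0 ≤ C₁ ∧ 0 ≤ C₂ ∧ ∀ (T : ℝ), 0 < T → ∀ (f : ℝ → E3 → E3), IsForce f →
    ∀ (v₀ : E3 → E3) (u : ℝ → E3 → E3) (p : ℝ → E3 → ℝ), IsLocalForcedSolution ν T f v₀ u p →
      ∀ t ∈ Ico 0 T, ∃ D : ℝ, HasDerivWithinAt (ensq u) D (Ici t) t ∧
        D ≤ C₁ * ensq u t + C₂ * ensq u t ^ 3 + curlSq f t

/-- **Step 4.1 — Lemma 4.1 AS USED** («Therefore, the vorticity remains uniformly bounded and the bootstrap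
assumption is self-consistent», p.4 l.59, from «dy/dt ≤ C₁y + C₂y³ + F₀²» l.38–48), at the ODE grain the
lemma is stated in: for constants `C₁ ≥ 0`, `C₂ > 0`, `F₀ ≥ 0`, every `T > 0` and every nonnegative `y` on
`[0,T)` whose right derivative obeys `y' ≤ C₁y + C₂y³ + F₀²` at every `t ∈ [0,T)` is BOUNDED on `[0,T)`. Typist's
flag: known-false pattern at the ODE grain (the comparison equation `z' = C₂z³` leaves every bound in finite
time: `z = y₀(1 − 2C₂y₀²t)^{−1/2}`); the printed proof's «standard ODE theory implies z(t) stays finite on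
[0,T]» is the gap. [cite: Fathi2025, Lemma 4.1 p.4 l.43–59] -/
def Step41_used : Prop :=
  ∀ (C₁ C₂ F₀ : ℝ), 0 ≤ C₁ → 0 < C₂ → 0 ≤ F₀ → ∀ (T : ℝ), 0 < T → ∀ (y D : ℝ → ℝ),
    (∀ t ∈ Ico 0 T, 0 ≤ y t) →
    (∀ t ∈ Ico 0 T, HasDerivWithinAt y (D t) (Ici t) t ∧ D t ≤ C₁ * y t + C₂ * y t ^ 3 + F₀ ^ 2) →
      ∃ M : ℝ, ∀ t ∈ Ico 0 T, y t ≤ M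

/-- **Step 4.1′ — the §4.1 inference as printed** (p.4 l.24–42, l.59): the enstrophy inequality (Step 3.2) and
Lemma 4.1 as used give a bounded enstrophy on `[0,T)` for every forced local class solution («assuming
‖∇×f(t)‖_{L²} ≤ F₀ uniformly» — true for a compactly supported smooth force). Typed as the implication.
[cite: Fathi2025, §4.1 p.4 l.24–59] -/
def Step41_inference : Prop :=
  Step32_ineq → Step41_used → VortBoundedAll

/-- **Step 4.2a — the `H^s` energy inequality** (p.5 l.7–14 «d/dt E_s + ν‖u‖²_{H^{s+1}} ≤ C_s‖u‖³_{H^s} +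
‖f‖²_{H^s}», Lemma 4.2 Kato–Ponce), rendered with `s = 3`, the good term dropped (weaker), as a right
derivative of `t ↦ (hs3 u t).toReal`: `≤ C_s E^{3/2} + ‖f‖²_{H³}` with `E^{3/2} = E·√E`. Classical for
`s > 5/2`, TRUE-type. [cite: Fathi2025, §4.2 p.5 l.7–23] -/
def Step42_cubic : Prop :=
  ∀ ν : ℝ, 0 < ν → ∃ Cs : ℝ, 0 ≤ Cs ∧ ∀ (T : ℝ), 0 < T → ∀ (f : ℝ → E3 → E3), IsForce f →
    ∀ (v₀ : E3 → E3) (u : ℝ → E3 → E3) (p : ℝ → E3 → ℝ), IsLocalForcedSolution ν T f v₀ u p →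
      ∀ t ∈ Ico 0 T, ∃ D : ℝ, HasDerivWithinAt (fun s => (hs3 u s).toReal) D (Ici t) t ∧
        D ≤ Cs * ((hs3 u t).toReal * Real.sqrt (hs3 u t).toReal) + hs3Force f t

/-- **Step 4.2b — «Choosing K large enough to dominate the right-hand side ensures the estimate closes»**
(p.5 l.44), at the real-arithmetic grain of the display it refers to («‖u(t)‖²_{H^s} ≤ ‖u₀‖²_{H^s} + C_sK^{3/2}T
+ ∫₀ᵀ‖f‖²_{H^s}», l.34–43, under the bootstrap assumption `‖u‖²_{H^s} ≤ K`): for `E₀ ≥ 0`, `C_s > 0`, `T > 0`,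
`F ≥ 0`, ALL SUFFICIENTLY LARGE `K` satisfy `E₀ + C_s K^{3/2} T + F ≤ K` (`K^{3/2} = K√K`). Typist's flag:
known-false pattern (`K√K` outgrows `K`; the closure holds only for SMALL `E₀ + F` relative to `(C_sT)^{−2}`,
i.e. small data / short time). [cite: Fathi2025, §4.2 p.5 l.34–45] -/
def Step42_close : Prop :=
  ∀ (E₀ Cs T F : ℝ), 0 ≤ E₀ → 0 < Cs → 0 < T → 0 ≤ F →
    ∃ K₀ : ℝ, ∀ K : ℝ, K₀ ≤ K → E₀ + Cs * (K * Real.sqrt K) * T + F ≤ K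

/-- **Step 4.2c — the §4.2 inference as printed** («which yields … Integrating gives … Choosing K … Hence
‖u(t)‖_{H^s} remains uniformly bounded on [0,T]», p.5 l.24–45): the cubic inequality and the closure sentence
give bounded `H^s` sums on `[0,T)` for every forced local class solution. Typed as the implication.
[cite: Fathi2025, §4.2 p.5 l.24–45] -/
def Step42_inference : Prop :=
  Step42_cubic → Step42_close →
    ∀ (ν T : ℝ), 0 < ν → 0 < T → ∀ (f : ℝ → E3 → E3), IsForce f → ∀ (v₀ : E3 → E3) (u : ℝ → E3 → E3)
      (p : ℝ → E3 → ℝ), IsLocalForcedSolution ν T f v₀ u p → HsBounded T u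

/-- **Step 5 — §4.3 + §5 as used** (p.5 l.46–49; §5.1–5.3 pp.5–6: Sobolev embedding «‖ω‖_{L∞} ≲ ‖u‖_{H^s}»,
«∫₀ᵀ‖ω‖_{L∞} ≤ T·sup < ∞», BKM «the solution u(t) can be continued beyond time T»): a forced local class
solution with bounded `H^s` sums on `[0,T)` does not blow up at `T`. In the rendering this is definitional
(`HsBounded T u ↔ ¬ BlowsUpAt T u`); TRUE. [cite: Fathi2025, §5 pp.5–6] [cite: BealeKatoMajda1984, Thm 1] -/
def Step5_BKM : Prop :=
  ∀ (ν T : ℝ) (f : ℝ → E3 → E3) (v₀ : E3 → E3) (u : ℝ → E3 → E3) (p : ℝ → E3 → ℝ),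
    IsLocalForcedSolution ν T f v₀ u p → HsBounded T u → ¬ BlowsUpAt T u

/-- Step 5 holds (definitional in the rendering). [cite: Fathi2025, §5.3 p.6 l.15–18] -/
theorem step5_BKM_holds : Step5_BKM :=
  fun _ _ _ _ _ _ _ hb => hsBounded_iff_not_blowsUpAt.1 hb

/-! ## Composition -/

/-- **COMPOSITION — the printed §2.3 → §4.2 → §5 logic reaches Theorem 1.1 (existence)**: by the dichotomy
(Step 2.3′) either a global solution exists or a class solution on some `[0,T)` blows up at `T`; §4.2 (cubic
inequality + «choosing K large» + the printed inference) bounds the `H^s` sums on `[0,T)`, which is `¬` blow-up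
(Step 5, discharged) — contradiction. Pure logic; nothing asserted. [cite: Fathi2025, §5.3 p.6 l.15–18] -/
theorem claim_of_steps (h23 : Step23_local) (h42a : Step42_cubic) (h42b : Step42_close)
    (h42 : Step42_inference) : ClaimedTheorem := by
  intro ν hν v₀ hv₀ f hf
  rcases h23 ν hν v₀ hv₀ f hf with hglob | ⟨T, hT, u, p, hsol, hblow⟩
  · exact hglob
  · exact absurd hblow (step5_BKM_holds ν T f v₀ u p hsol (h42 h42a h42b ν T hν hT f hf v₀ u p hsol))

/-- **The §4.1 branch** (typed, NOT consumed by §4.2–§5 in print): Step 3.2 and Lemma 4.1-as-used give, through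
the printed inference, a bounded enstrophy on every existence slab. Pure logic. [cite: Fathi2025, §4.1 p.4] -/
theorem claim_of_steps_vort (h32 : Step32_ineq) (h41 : Step41_used) (hinf : Step41_inference) :
    VortBoundedAll :=
  hinf h32 h41

/-! ## Rev 2 (append-only) — the «unique» clause of Theorem 1.1 holds in the rendering -/

/-- **`ClaimedUniqueness` DISCHARGED**: two global forced class solutions with the same datum and force agree
at every `t ≥ 0` — the tree's Majda–Bertozzi Cor. 3.1 in the BKM class WITH force
(`IsClassicalNSSolutionOn.eq_of_hasBoundedSobolevNormsOn`, `ν ≥ 0`) on the slab `[0, t+1]`. (The printed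
«unique» is thus not where the paper breaks.) [cite: Fathi2025, Thm 1.1 p.2 l.15] -/
theorem claimedUniqueness_holds : ClaimedUniqueness := by
  intro ν hν v₀ _hv₀ f _hf u u' p p' hu hu' t ht
  have hT : (0:ℝ) < t + 1 := by linarith
  have hU : UniqueDiffOn ℝ (Icc (0:ℝ) (t + 1)) := uniqueDiffOn_Icc hT
  have h1c : IsClassicalNSSolutionOn (Icc 0 (t + 1)) ν f u p := hu.isClassical.mono Icc_subset_Ici_self hU
  have h2c : IsClassicalNSSolutionOn (Icc 0 (t + 1)) ν f u' p' :=
    hu'.isClassical.mono Icc_subset_Ici_self hU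
  have h0 : u' 0 = u 0 := by rw [hu'.initial, hu.initial]
  exact h2c.eq_of_hasBoundedSobolevNormsOn h1c hν.le hT (hu'.sobolev (t + 1)) (hu.sobolev (t + 1)) h0
    ⟨ht, by linarith⟩

/-! ## Rev 3 (append-only) — the §4.1 inference is valid plumbing: `Step41_inference` discharged -/

/-- Slices of a `C_c^∞` space-time force have uniformly bounded Jacobians, vanishing off the spatial
projection of the support. [cite: Fathi2025, Thm 1.1 p.2 l.10–15 («f ∈ C_c^∞»)] -/
theorem exists_fderiv_slice_bound {f : ℝ → E3 → E3} (hf : IsForce f) :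
    ∃ B : ℝ, 0 ≤ B ∧ (∀ t x, ‖fderiv ℝ (f t) x‖ ≤ B) ∧
      ∀ t x, (t, x) ∉ tsupport (Function.uncurry f) → fderiv ℝ (f t) x = 0 := by
  obtain ⟨hg, hK⟩ := hf
  set g := Function.uncurry f with hg_def
  have hDg_cont : Continuous (fderiv ℝ g) := hg.continuous_fderiv (by simp)
  have hDg_supp : HasCompactSupport (fderiv ℝ g) := hK.fderiv (𝕜 := ℝ)
  obtain ⟨B, hB⟩ := hDg_supp.exists_bound_of_continuous hDg_cont
  have hslice : ∀ t x, HasFDerivAt (f t) ((fderiv ℝ g (t, x)).comp (ContinuousLinearMap.inr ℝ ℝ E3)) x := by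
    intro t x
    have h1 : HasFDerivAt g (fderiv ℝ g (t, x)) (t, x) :=
      ((hg.differentiable (by simp)) (t, x)).hasFDerivAt
    have h2 : HasFDerivAt (fun y : E3 => (t, y)) (ContinuousLinearMap.inr ℝ ℝ E3) x := hasFDerivAt_prodMk_right t x
    have := h1.comp x h2
    exact this
  refine ⟨max B 0, le_max_right _ _, fun t x => ?_, fun t x hx => ?_⟩
  · rw [(hslice t x).fderiv]
    refine ContinuousLinearMap.opNorm_le_bound _ (le_max_of_le_right le_rfl) fun v => ?_
    calc ‖((fderiv ℝ g (t, x)).comp (ContinuousLinearMap.inr ℝ ℝ E3)) v‖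
        = ‖fderiv ℝ g (t, x) ((0 : ℝ), v)‖ := rfl
      _ ≤ ‖fderiv ℝ g (t, x)‖ * ‖((0 : ℝ), v)‖ := ContinuousLinearMap.le_opNorm _ _
      _ ≤ max B 0 * ‖v‖ := by
          have hn : ‖((0 : ℝ), v)‖ = ‖v‖ := by simp [Prod.norm_def]
          rw [hn]
          exact mul_le_mul_of_nonneg_right ((hB _).trans (le_max_left _ _)) (norm_nonneg _)
  · rw [(hslice t x).fderiv]
    have h0 : fderiv ℝ g (t, x) = 0 := by
      have hx' : (t, x) ∉ tsupport (fderiv ℝ g) := fun h => hx (tsupport_fderiv_subset (𝕜 := ℝ) h)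
      exact image_eq_zero_of_notMem_tsupport hx'
    rw [h0]; simp

/-- «assuming ‖∇×f(t)‖_{L²} ≤ F₀ uniformly» (§4.1 p.4 l.37) HOLDS for a `C_c^∞` force: `‖∇×f(t)‖²_{L²} ≤ F₀²`
for all `t`. [cite: Fathi2025, §4.1 p.4 l.35–37] -/
theorem exists_curlSq_le {f : ℝ → E3 → E3} (hf : IsForce f) :
    ∃ F : ℝ, 0 ≤ F ∧ ∀ t, curlSq f t ≤ F ^ 2 := by
  obtain ⟨B, hB0, hB, hoff⟩ := exists_fderiv_slice_bound hf
  obtain ⟨_, hK⟩ := hf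
  set S : Set E3 := Prod.snd '' tsupport (Function.uncurry f) with hS
  have hScpt : IsCompact S := hK.image continuous_snd
  have hSvol : volume S < ⊤ := hScpt.measure_lt_top
  set c : ℝ := ‖(curlCLM : (E3 →L[ℝ] E3) →L[ℝ] E3)‖ with hc
  have hc0 : 0 ≤ c := norm_nonneg (curlCLM : (E3 →L[ℝ] E3) →L[ℝ] E3)
  -- pointwise bound by an indicator
  have hpt : ∀ t x, (‖curl (f t) x‖ₑ : ℝ≥0∞) ^ 2 ≤ S.indicator (fun _ => ENNReal.ofReal ((c * B) ^ 2)) x := by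
    intro t x
    by_cases hx : x ∈ S
    · rw [indicator_of_mem hx]
      have h1 : ‖curl (f t) x‖ ≤ c * B :=
        (norm_curl_le (f t) x).trans (mul_le_mul_of_nonneg_left (hB t x) hc0)
      calc (‖curl (f t) x‖ₑ : ℝ≥0∞) ^ 2 = ENNReal.ofReal (‖curl (f t) x‖ ^ 2) := by
            rw [← ofReal_norm, ENNReal.ofReal_pow (norm_nonneg _)]
        _ ≤ ENNReal.ofReal ((c * B) ^ 2) := by
            apply ENNReal.ofReal_le_ofReal
            exact pow_le_pow_left₀ (norm_nonneg _) h1 2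
    · rw [indicator_of_notMem hx]
      have hx' : (t, x) ∉ tsupport (Function.uncurry f) := fun h => hx ⟨(t, x), h, rfl⟩
      have : curl (f t) x = 0 := by
        rw [curl_eq_curlCLM, hoff t x hx', map_zero]
      simp [this]
  refine ⟨c * B * Real.sqrt (volume S).toReal, by positivity, fun t => ?_⟩
  have hint : (∫⁻ x, (‖curl (f t) x‖ₑ : ℝ≥0∞) ^ 2) ≤ ENNReal.ofReal ((c * B) ^ 2) * volume S := by
    calc (∫⁻ x, (‖curl (f t) x‖ₑ : ℝ≥0∞) ^ 2)
        ≤ ∫⁻ x, S.indicator (fun _ => ENNReal.ofReal ((c * B) ^ 2)) x := lintegral_mono (hpt t)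
      _ = ENNReal.ofReal ((c * B) ^ 2) * volume S := by
          rw [lintegral_indicator hScpt.measurableSet, setLIntegral_const]
  have hne : ENNReal.ofReal ((c * B) ^ 2) * volume S ≠ ⊤ :=
    ENNReal.mul_ne_top ENNReal.ofReal_ne_top hSvol.ne
  unfold curlSq
  calc (∫⁻ x, (‖curl (f t) x‖ₑ : ℝ≥0∞) ^ 2).toReal ≤ (ENNReal.ofReal ((c * B) ^ 2) * volume S).toReal :=
        ENNReal.toReal_mono hne hint
    _ = (c * B) ^ 2 * (volume S).toReal := by
        rw [ENNReal.toReal_mul, ENNReal.toReal_ofReal (by positivity)]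
    _ = (c * B * Real.sqrt (volume S).toReal) ^ 2 := by
        rw [mul_pow (c * B), Real.sq_sqrt ENNReal.toReal_nonneg]

/-- **`Step41_inference` DISCHARGED**: the printed §4.1 inference is valid — given the enstrophy
inequality (Step 3.2) and Lemma 4.1 as used, every forced local class solution has bounded enstrophy on
`[0,T)` («assuming ‖∇×f(t)‖_{L²} ≤ F₀ uniformly» holds for a `C_c^∞` force: `exists_curlSq_le`). So the
§4.1 branch breaks exactly at Lemma 4.1 (`Step41_used`, refuted in the kernel), not at the plumbing.
[cite: Fathi2025, §4.1 p.4 l.24–59] -/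
theorem step41_inference_holds : Step41_inference := by
  intro h32 h41 ν T hν hT f hf v₀ u p hsol
  obtain ⟨C₁, C₂, hC₁, hC₂, h32'⟩ := h32 ν hν
  obtain ⟨F, hF0, hF⟩ := exists_curlSq_le hf
  have hstep := h32' T hT f hf v₀ u p hsol
  choose D hD using hstep
  classical
  let D' : ℝ → ℝ := fun t => if h : t ∈ Ico 0 T then D t h else 0
  have hy : ∀ t, 0 ≤ ensq u t := fun t => ENNReal.toReal_nonneg
  refine h41 C₁ (C₂ + 1) F hC₁ (by linarith) hF0 T hT (ensq u) D' (fun t _ => hy t) fun t ht => ?_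
  obtain ⟨hderiv, hle⟩ := hD t ht
  have hD' : D' t = D t ht := by simp only [D', dif_pos ht]
  rw [hD']
  refine ⟨hderiv, ?_⟩
  have h3 : 0 ≤ ensq u t ^ 3 := pow_nonneg (hy t) 3
  calc D t ht ≤ C₁ * ensq u t + C₂ * ensq u t ^ 3 + curlSq f t := hle
    _ ≤ C₁ * ensq u t + (C₂ + 1) * ensq u t ^ 3 + F ^ 2 := by nlinarith [hF t]

/-- `Step41_inference` — `_holds` alias of `step41_inference_holds` above under the fact's exact name (appended
2026-08-28, D-0026 bookkeeping: the proof term is the existing theorem of this file; no statement,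
definition or attribute is edited; no new named fact; the ledger's debt table listed the fact
unproved). [cite: Fathi2025, §4.1 p.4 l.24–59] -/
theorem _root_.Literature.Claims.NS.Fathi2025.Step41_inference_holds : Step41_inference :=
  _root_.Literature.Claims.NS.Fathi2025.step41_inference_holds

end Literature.Claims.NS.Fathi2025

end

-- WHAT THIS IS NOT: not a claim about NS regularity or blow-up; not a claim about any author beyond the typed locator.
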